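import Literature.AnabelianGeometry.EtaleTheta.EtaleThetaClass
import Literature.AnabelianGeometry.EtaleTheta.ThetaCyclotomes
import Literature.AnabelianGeometry.EtaleTheta.SettingGaloisFacts
import HarnessLib

/-!
# [EtTh] §1: the containments `ThetaSetting.Compat` are theorems of the root data
# (two outright, the third from the §2 hypothesis `Sec2Hyps`)

Mochizuki, *The étale theta function …*, Publ. RIMS **45** (2009), §1, PRIMS PDF pp. 12–13, 17, 22–23
(printed 238–239, 243, 248–249) [cite: MochizukiEtTh2009, Prop 1.5 p.22]. Layer L2 of the abc-iut
cell, seat abc-iut-L2-t1. PROOF-ONLY companion (no `def`) of `EtaleThetaClass.lean` (the hypothesis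
structure `ThetaSetting.Compat`, seat abc-iut-L2-t1) and `ThetaCyclotomes.lean` (`ThetaSetting.Sec2Hyps`,
seat abc-iut-L2-t8).

`Compat` records three printed containments among the §1 groups that `Setting.lean` does not carry as
fields and that every cohomological statement of §1 (Props. 1.4 (iii), 1.5, Thm. 1.6 (iii), Def. 1.9,
Thm. 1.10) and the §2 adapter take as a hypothesis `(hC : D.Compat)`. This file PROVES:
* `deltaTheta_le_DtpYTheta` — "`Δ_Θ ⊆ (Δ^tp_Y)^Θ`" (Prop. 1.5 (i), p. 22) OUTRIGHT from the root axioms: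
  `Δ_Θ` is the image of `Ker(Π^tp_X ↠ (Π^tp_X)^ell)`, which lies in `Δ^tp_X` (the printed kernel is
  induced from `Δ_X`, `ker_toEll`) and in `Π^tp_Y` (`ThetaSetting.ker_toEll_le_GtpY`, proved by
  abc-iut-L2-t8 from the profinite-completion axiom);
* `comap_aug_GKN_two_normal` — `K̈/K` Galois: the pull-back of `G_K̈ = G_{K₂}` to `Π^tp_X` is normal,
  OUTRIGHT (`G_{K₂} ⊴ G_K`, `SettingGaloisFacts`, and the image of `Π^tp_X` is `G_K`);
* `deltaTheta_le_DtpYddTheta_of` — "`Δ_Θ ⊆ (Δ^tp_Ÿ)^Θ`" (Prop. 1.5 (ii), p. 23) from the single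
  containment `Ker(Π^tp_Y ↠ (Π^tp_Y)^ell) ⊆ Π^tp_{Y₂}` (p. 13: `Y_N → Y` is cut out inside `(Π^tp_Y)^ell`),
  which is the field `Sec2Hyps.ker_toEll_le_GtpYN` at `N = 2` and is NOT a consequence of the root
  axioms (the root records `[Δ^tp_Y : Δ^tp_{Y_N}] = N` but not that `Δ^tp_X/Δ^tp_{Y_N}` is abelian);
* hence `Compat.of_ker_toEll_le_GtpYN` and **`Sec2Hyps.compat : D.Sec2Hyps → D.Compat`** — consumers
  holding `Sec2Hyps` need not assume `Compat` separately (one hypothesis structure fewer in the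
  kernel DAG of the §1/§2 model).
HONEST FRAMING: hypothesis bookkeeping only; nothing of [EtTh] is asserted; no side is taken on any
disputed claim.
-/

namespace Literature.AnabelianGeometry.EtaleTheta

open Literature.AnabelianGeometry.SemiGraphs

namespace ThetaSetting

variable {p : ℕ} [Fact p.Prime] (D : ThetaSetting p)

/-- `Δ_Θ = Ker((Π^tp_X)^Θ ↠ (Π^tp_X)^ell)` is the image in `(Π^tp_X)^Θ` of `Ker(Π^tp_X ↠ (Π^tp_X)^ell)`
(p. 12; `Π^tp_X ↠ (Π^tp_X)^Θ` is surjective). [cite: MochizukiEtTh2009, §1 p.12] -/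
theorem deltaTheta_eq_map_ker :
    D.DeltaTheta = (D.thetaToEll.comp D.toTheta).ker.map D.toTheta := by
  ext x
  constructor
  · intro hx
    obtain ⟨g, rfl⟩ := D.toTheta_surjective x
    exact ⟨g, hx, rfl⟩
  · rintro ⟨g, hg, rfl⟩
    exact hg

/-- **"`Δ_Θ ⊆ (Δ^tp_Y)^Θ ⊆ (Π^tp_Y)^Θ`"** (Prop. 1.5 (i), p. 22) — PROVED from the root axioms: the kernel
of `Π^tp_X ↠ (Π^tp_X)^ell` lies in `Δ^tp_X` and in `Π^tp_Y`. [cite: MochizukiEtTh2009, Prop 1.5 (i) p.22] -/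
theorem deltaTheta_le_DtpYTheta : D.DeltaTheta ≤ D.DtpYTheta := by
  rw [deltaTheta_eq_map_ker]
  exact Subgroup.map_mono (le_inf D.ker_toEll_le_GtpY D.ker_toEll_le_deltaTemp)

/-- **`K̈/K` is Galois, pulled back to `Π^tp_X`**: the inverse image of `G_K̈ = G_{K₂}` under
`Π^tp_X → G_{ℚ_p}` is a normal subgroup (`G_{K₂} ⊴ G_K` and the image of `Π^tp_X` is `G_K`; p. 17
"`K̈ = K(ζ₂, q_X^{1/2})`"). [cite: MochizukiEtTh2009, §1 p.17] -/
theorem comap_aug_GKN_two_normal : ((D.GKN 2).comap D.aug.toMonoidHom).Normal := by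
  refine ⟨fun n hn g => ?_⟩
  rw [Subgroup.mem_comap] at hn ⊢
  have key := D.GKdd_normal.conj_mem ⟨D.aug.toMonoidHom n, D.aug_mem_GK n⟩
    (Subgroup.mem_subgroupOf.2 hn) ⟨D.aug.toMonoidHom g, D.aug_mem_GK g⟩
  rw [Subgroup.mem_subgroupOf] at key
  change _ ∈ D.GKdd
  simpa only [map_mul, map_inv, Subgroup.coe_mul, Subgroup.coe_inv] using key

/-- **"`Δ_Θ ⊆ (Δ^tp_Ÿ)^Θ ⊆ (Π^tp_Ÿ)^Θ`"** (Prop. 1.5 (ii), p. 23) from the containment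
`Ker(Π^tp_X ↠ (Π^tp_X)^ell) ∩ Π^tp_Y ⊆ Π^tp_{Y₂}` (p. 13; `Sec2Hyps.ker_toEll_le_GtpYN` at `N = 2`): that
kernel lies in `Δ^tp_X`, hence in `aug⁻¹(G_{J̈₁})`, hence in `Π^tp_Ÿ = Π^tp_{Y₂} ∩ aug⁻¹(G_{J̈₁})`.
[cite: MochizukiEtTh2009, Prop 1.5 (ii) p.23] -/
theorem deltaTheta_le_DtpYddTheta_of
    (h : (D.thetaToEll.comp D.toTheta).ker ⊓ D.GtpY ≤ D.GtpYN 2) :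
    D.DeltaTheta ≤ (D.DtpYddN 1).map D.toTheta := by
  rw [deltaTheta_eq_map_ker]
  apply Subgroup.map_mono
  intro g hg
  have hY : g ∈ D.GtpY := D.ker_toEll_le_GtpY hg
  have hΔ : g ∈ D.DeltaTemp := D.ker_toEll_le_deltaTemp hg
  have h2 : g ∈ D.GtpYN 2 := h ⟨hg, hY⟩
  have hone : D.aug.toMonoidHom g = 1 := hΔ
  refine Subgroup.mem_inf.2 ⟨Subgroup.mem_inf.2 ⟨?_, ?_⟩, hΔ⟩
  · simpa using h2
  · rw [Subgroup.mem_comap, hone]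
    exact one_mem _

/-- `Compat` from the single printed containment `Ker(Π^tp_X ↠ (Π^tp_X)^ell) ∩ Π^tp_Y ⊆ Π^tp_{Y₂}` (p. 13),
the other two fields being theorems. [cite: MochizukiEtTh2009, Prop 1.5 p.22] -/
theorem Compat.of_ker_toEll_le_GtpYN
    (h : (D.thetaToEll.comp D.toTheta).ker ⊓ D.GtpY ≤ D.GtpYN 2) : D.Compat :=
  ⟨D.deltaTheta_le_DtpYTheta, D.deltaTheta_le_DtpYddTheta_of h, D.comap_aug_GKN_two_normal⟩

variable {D} in
/-- **`Sec2Hyps → Compat`**: the §2 hypothesis structure of abc-iut-L2-t8 (whose field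
`ker_toEll_le_GtpYN` quotes p. 13) implies the §1 hypothesis structure `Compat` — consumers need not
assume both. [cite: MochizukiEtTh2009, Prop 1.5 p.22] -/
theorem Sec2Hyps.compat (hS : D.Sec2Hyps) : D.Compat :=
  Compat.of_ker_toEll_le_GtpYN D (hS.ker_toEll_le_GtpYN 2)

end ThetaSetting

end Literature.AnabelianGeometry.EtaleTheta
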